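import Literature.MathematicalPhysics.QuantumLattice.HeisenbergWindowCertificate
import Literature.MathematicalPhysics.QuantumLattice.HubbardWindowCertificateD4
import Literature.MathematicalPhysics.QuantumLattice.XYOrderGDProofs
import HarnessLib

/-!
# Window ("reduce"-mode, thermodynamic-limit) bootstrap certificates for the Heisenberg model on
# `ℤ^d` and on the SQUARE LATTICE with point-group (`D₄`) reductions

Family `hubbard` (topic `MathematicalPhysics/QuantumLattice`; calibration model of the bundle
papers/HubbardSuperconductivity/manybody-bootstrap/). Companion of `HeisenbergWindowCertificate`
(the chain, `d = 1`): X. Han's translation-invariant bootstrap (arXiv:2006.06002 §2–3: positivity,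
`F[[H,O]] = 0`, `F[U⁻¹OU] = F[O]` for the lattice translations and — on the square lattice — the
point group `{Π, R}`, charge conservation) and the bundle's reduce-mode certificates
(`certsdp/1`, `family = heisenberg`, `geometry = box`, `dims = [a, b]`, objective
`h₀ = J Σᵢ 𝐒_0 · 𝐒_{eᵢ}`, `hypotheses.reduce.point_group` = the `D₄` maps of the box) produce ONE
identity in the spin algebra `𝔄_{Λ'} = Op ↥Λ' (n+1)` of a window `Λ' ⊆ ℤ^d`,

  `J Σᵢ 𝐒_0·𝐒_{eᵢ} − c·1 = Σ Λₐᵦ Oₐᴴ O_b + (Σₖ [H_{Λ'}, Γ(incl) Bₖ] + Σₗ Dₗ + Σⱼ bⱼ • Wⱼ)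
       + (Σₘ dₘ • (Vₘᴴ − Vₘ) + Σₖ aₖ • Mₖ)`,

with symmetry differences `Dₗ = Γ(incl)(Γ(φₗ) Yₗ) − Γ(incl) Yₗ` along site maps `φₗ` of an inner
region `Λ` into `Λ'` that are restrictions of lattice symmetries: affine maps `x ↦ εx + v`
(`ε = ±1`, every `d`; `siteAffEmb`) or, for `d = 2`, affine `D₄` maps `x ↦ γ·x + w` (`siteD4Emb`,
`d4Vec`, `d4ShiftSet` of HubbardWindowCertificateD4). Pulling the window back into the torus
`(ℤ/Lℤ)^d` (`spinEmbed (spinToTorusEmb L _)`, injective on `Λ'`) turns every bracket into a null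
term of the tracial ground state — the symmetry differences become `P (Γ Y) Pᴴ − Γ Y` for the
permutation unitaries `P` of torus automorphisms (`spinEmbed_toTorus_aff_sub`,
`spinEmbed_toTorus_d4_sub`) — and the per-site decomposition
`Σ_v P_v Γ(J Σᵢ 𝐒_0·𝐒_{eᵢ}) P_vᴴ = H_L` (`sum_permOp_conj_spinDotStar`, every `d`, `L ≥ 3`) with
`Matrix.mul_card_le_minEnergyOn_of_local_certificate` (SymmetricLocalCertificate, `K = ⊤`) gives

  `(c − Σₖ ‖aₖ‖) · L^d ≤ groundEnergy (heisenbergHamiltonian n (torusGraph d L) J)`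

for EVERY `L ≥ 3` with `x ↦ x mod L` injective on `Λ'`:
* `heisenbergTorus_groundEnergy_ge_of_window_certificate_perm` — the workhorse, with the symmetry
  family given by torus automorphisms and their window-level differences;
* `heisenbergLattice_groundEnergy_ge_of_window_certificate` (every `d`, affine family) and
  `heisenbergSquare_groundEnergy_ge_of_window_certificate_d4` (`d = 2`, affine `D₄` family =
  Han's `T_(1,0), T_(0,1), Π, R`), with per-site forms `…_div_…` — the latter is the shape of the
  bundle's square-torus-wise thermodynamic-limit rows
  (`∀ L ≥ L₀, q ≤ groundEnergy (heisenbergHamiltonian 1 (torusGraph 2 L) 1) / L²`).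
Everything is PROVED; the definitions are the bookkeeping site maps `siteD4Emb`, `torusD4Aff`.

## References
* X. Han, *Quantum many-body bootstrap*, arXiv:2006.06002 (2020), §2 eq. (2) (constraints), §3
  (square lattice: `T_(1,0), T_(0,1), Π, R`). [cite: Han2020Bootstrap, §2–3]
* H. Tasaki, *Physics and Mathematics of Quantum Many-Body Systems* (Springer 2020), §2.4
  eq. (2.4.1) (Heisenberg Hamiltonian on a lattice with bond set), §2.5 (`SU(2)`/`U(1)` charges).
  [cite: Tasaki2020, §2.4–2.5]
* D. J. Scalapino, Phys. Rep. 250 (1995) 329, §2 (square-lattice point group `C₄ᵥ ≅ D₄`).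
  [cite: Scalapino1995, §2]
* O. Bratteli, D. W. Robinson, *Operator Algebras and Quantum Statistical Mechanics II*, 2nd ed.,
  §6.2.1 (local structure and lattice symmetries of quantum spin systems). [cite: BratteliRobinsonII1997, §6.2.1]
-/

noncomputable section

namespace Literature.MathematicalPhysics.QuantumLattice

open Matrix Finset Literature.Probability.LatticeModels
open Literature.MathematicalPhysics.QuantumManyBody.StateRelaxation
open scoped ComplexOrder BigOperators

/-! ### The per-site decomposition of the Heisenberg Hamiltonian of `(ℤ/Lℤ)^d` -/

section Torus

variable {d L : ℕ} [NeZero L]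

/-- For `L ≥ 3` every bond of `(ℤ/Lℤ)^d` is `{x, x + eᵢ}` for exactly one pair `(x, i)`:
`H_L(J) = J Σ_x Σᵢ 𝐒_x · 𝐒_{x+eᵢ}` (the tree's `sum_pairs_eq_sum_edgeFinset'`).
Tasaki (2020) §2.4, eq. (2.4.1). [cite: Tasaki2020, §2.4] -/
theorem heisenbergHamiltonian_torusGraph_eq_sum_spinDot (n : ℕ) (hL : 3 ≤ L) (J : ℝ) :
    heisenbergHamiltonian n (torusGraph d L) J =
      (J : ℂ) • ∑ x : TorusSite d L, ∑ i : Fin d, spinDot n x (x + Pi.single i 1) := by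
  unfold heisenbergHamiltonian
  rw [← sum_pairs_eq_sum_edgeFinset' L hL]
  rfl

/-- **The per-site decomposition of the Heisenberg Hamiltonian of the torus `(ℤ/Lℤ)^d`**
(`L ≥ 3`, any `d`): `Σ_{v} P_v (Σᵢ 𝐒_0 · 𝐒_{eᵢ}) P_vᴴ = Σ_{bonds} 𝐒_x · 𝐒_y = H_L(J = 1)` with `P_v`
the translation unitaries — the energy DENSITY `h₀ = Σᵢ 𝐒_0·𝐒_{eᵢ}` of Han's bootstrap summed over
its translates. Tasaki (2020) §2.4, eq. (2.4.1); Han 2020 §2. [cite: Tasaki2020, §2.4] -/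
theorem sum_permOp_conj_spinDotStar (n : ℕ) (hL : 3 ≤ L) :
    ∑ v : TorusSite d L, permOp (torusAff 1 v) *
        (∑ i : Fin d, spinDot n (Torus.proj L (0 : Site d)) (Torus.proj L (unitVec i : Site d))) *
        (permOp (torusAff 1 v))ᴴ =
      heisenbergHamiltonian n (torusGraph d L) 1 := by
  have h0 : Torus.proj L (0 : Site d) = 0 := by funext j; simp [Torus.proj]
  have he : ∀ i : Fin d, Torus.proj L (unitVec i : Site d) = Pi.single i 1 := by
    intro i
    funext j
    by_cases h : j = i
    · subst h; simp [Torus.proj]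
    · simp [Torus.proj, h]
  rw [heisenbergHamiltonian_torusGraph_eq_sum_spinDot n hL 1, Complex.ofReal_one, one_smul]
  refine Finset.sum_congr rfl fun v _ => ?_
  rw [Finset.mul_sum, Finset.sum_mul]
  refine Finset.sum_congr rfl fun i _ => ?_
  rw [permOp_mul_mul_conjTranspose, reindexOp_spinDot, torusAff_one, h0, he i]
  simp only [Equiv.coe_addRight, zero_add]
  rw [add_comm (Pi.single i (1 : ZMod L)) v]

end Torus

/-! ### The workhorse: window certificate with symmetry defects along torus automorphisms -/

section Workhorse

variable {d L : ℕ} [NeZero L]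

/-- **Window certificate ⇒ ground-state energy of EVERY large Heisenberg torus `(ℤ/Lℤ)^d`**, with
the symmetry family presented by torus automorphisms. Data: a window `Λ' ⊆ ℤ^d` containing
`0, e₁, …, e_d` (so that the energy density `J Σᵢ 𝐒_0 · 𝐒_{eᵢ}` lives in it), an inner region
`Λ ⊆ Λ'` all of whose lattice neighbours lie in `Λ'`, `x ↦ x mod L` injective on `Λ'`; an identity
in `𝔄_{Λ'} = Op ↥Λ' (n+1)`
`J Σᵢ 𝐒_0·𝐒_{eᵢ} − c·1 = Σ Λₐᵦ Oₐᴴ O_b + (Σₖ (H_{Λ'} Γ(incl)Bₖ − Γ(incl)Bₖ H_{Λ'}) + Σₗ Dₗ + Σⱼ bⱼ • Wⱼ)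
   + (Σₘ dₘ • (Vₘᴴ − Vₘ) + Σₖ aₖ • Mₖ)`
with `Λ ⪰ 0`, `H_{Λ'}` the free-boundary Heisenberg Hamiltonian of the window (`windowGraph`),
`Bₖ ∈ 𝔄_Λ`, window terms `Dₗ` whose pull-backs are symmetry defects `P_{eₗ} Yₗ P_{eₗ}ᴴ − Yₗ` of the
permutation unitaries of graph automorphisms `eₗ` of the torus, `S^z`-CHARGED `Wⱼ`
(`[S^z_{Λ'}, Wⱼ] = mⱼ Wⱼ`, `mⱼ ≠ 0`), real `dₘ`, contractions `Mₖ`. Then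
`(c − Σₖ ‖aₖ‖) · L^d ≤ E₀(H_L)`, `H_L = J Σ_{bonds of (ℤ/Lℤ)^d} 𝐒_x · 𝐒_y`, for every `L ≥ 3`.
Han 2020 §2 (positivity, `F[[H,O]] = 0`, `F[U⁻¹OU] = F[O]`, charge conservation), read on the torus
through its tracial ground state (`Matrix.mul_card_le_minEnergyOn_of_local_certificate`, `K = ⊤`).
[cite: Han2020Bootstrap, §2] -/
theorem heisenbergTorus_groundEnergy_ge_of_window_certificate_perm (n : ℕ) (J : ℝ) (hL : 3 ≤ L)
    {Λ Λ' : Finset (Site d)} (hΛ : Λ ⊆ Λ')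
    (hclosed : ∀ x ∈ Λ, ∀ i : Fin d, x + unitVec i ∈ Λ' ∧ x - unitVec i ∈ Λ')
    (hz : (0 : Site d) ∈ Λ') (he : ∀ i : Fin d, (unitVec i : Site d) ∈ Λ')
    (hInj : Set.InjOn (Torus.proj (d := d) L) ↑Λ')
    {m : Type*} [Fintype m] [DecidableEq m] {Λm : Matrix m m ℂ} (hΛm : Λm.PosSemidef)
    (O : m → Op ↥Λ' (n + 1))
    {κ : Type*} (s : Finset κ) (B : κ → Op ↥Λ (n + 1))
    {ι : Type*} (tt : Finset ι) (e : ι → Equiv.Perm (TorusSite d L))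
    (hadj : ∀ l ∈ tt, ∀ x y, (torusGraph d L).Adj (e l x) (e l y) ↔ (torusGraph d L).Adj x y)
    (D : ι → Op ↥Λ' (n + 1)) (Yt : ι → Op (TorusSite d L) (n + 1))
    (hD : ∀ l ∈ tt, spinEmbed (spinToTorusEmb L hInj) (D l) =
      permOp (e l) * Yt l * (permOp (e l))ᴴ - Yt l)
    {ρ : Type*} (u : Finset ρ) (b : ρ → ℂ) (W : ρ → Op ↥Λ' (n + 1)) (mq : ρ → ℂ)
    (hmq : ∀ j ∈ u, mq j ≠ 0)
    (hW : ∀ j ∈ u, totalSpin n 2 * W j - W j * totalSpin n 2 = mq j • W j)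
    {δ : Type*} (ah : Finset δ) (dc : δ → ℝ) (V : δ → Op ↥Λ' (n + 1))
    {κ'' : Type*} (w : Finset κ'') (a : κ'' → ℂ) (M : κ'' → Op ↥Λ' (n + 1))
    (hM : ∀ k ∈ w, (M k).IsContraction) {c : ℝ}
    (hcert : (J : ℂ) • (∑ i : Fin d, spinDot n (⟨0, hz⟩ : ↥Λ') ⟨unitVec i, he i⟩) -
        (c : ℂ) • (1 : Op ↥Λ' (n + 1)) =
      gramForm Λm O +
        (∑ k ∈ s, (heisenbergHamiltonian n (windowGraph Λ') J * spinEmbed (siteIncl hΛ) (B k) -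
            spinEmbed (siteIncl hΛ) (B k) * heisenbergHamiltonian n (windowGraph Λ') J) +
          ∑ l ∈ tt, D l +
          ∑ j ∈ u, b j • W j) +
        (∑ m' ∈ ah, ((dc m' : ℝ) : ℂ) • ((V m')ᴴ - V m') + ∑ k ∈ w, a k • M k)) :
    (c - ∑ k ∈ w, ‖a k‖) * (L : ℝ) ^ d ≤ (heisenbergHamiltonian n (torusGraph d L) J).groundEnergy := by
  classical
  set Γ' := spinEmbed (q := n + 1) (spinToTorusEmb L hInj) with hΓ'
  set H := heisenbergHamiltonian n (torusGraph d L) J with hH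
  have hHh : H.IsHermitian := heisenbergHamiltonian_isHermitian n _ J
  set X := Γ' ((J : ℂ) • ∑ i : Fin d, spinDot n (⟨0, hz⟩ : ↥Λ') ⟨unitVec i, he i⟩) with hX
  have hXe : X = (J : ℂ) • ∑ i : Fin d,
      spinDot n (Torus.proj L (0 : Site d)) (Torus.proj L (unitVec i : Site d)) := by
    rw [hX, map_smul, map_sum]
    refine congrArg _ (Finset.sum_congr rfl fun i _ => ?_)
    rw [hΓ', spinEmbed_spinDot, spinToTorusEmb_apply, spinToTorusEmb_apply]
  -- translations and the per-site decomposition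
  set T : TorusSite d L → Op (TorusSite d L) (n + 1) := fun v' => permOp (torusAff 1 v') with hT
  have hTH : ∀ v', T v' * H = H * T v' := fun v' => permOp_torusAff_mul_heisenbergHamiltonian n 1 v' J
  have hTT : ∀ v', (T v')ᴴ * T v' = 1 := fun v' => conjTranspose_permOp_mul _
  have hsum : ∑ v', T v' * X * (T v')ᴴ = H := by
    have hdec := sum_permOp_conj_spinDotStar (d := d) (L := L) n hL
    rw [hH, heisenbergHamiltonian_eq_smul_one n (torusGraph d L) J, ← hdec, Finset.smul_sum]
    refine Finset.sum_congr rfl fun v' _ => ?_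
    rw [hT, hXe]
    simp only [Matrix.mul_smul, Matrix.smul_mul]
  -- the sector is the whole space
  have hK : (⊤ : Submodule ℂ (TensorIndex (TorusSite d L) (n + 1) → ℂ)) ≠ ⊥ := top_ne_bot
  -- symmetry family
  set Us : ι → Op (TorusSite d L) (n + 1) := fun l => permOp (e l) with hUs
  have hU : ∀ l ∈ tt, Us l * H = H * Us l := fun l hl =>
    (permOp_mul_eq_mul_permOp_iff _ _).2 (reindexOp_heisenbergHamiltonian n _ _ (e l) (hadj l hl) J)
  have hUU : ∀ l ∈ tt, (Us l)ᴴ * Us l = 1 := fun l _ => conjTranspose_permOp_mul _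
  -- charge family
  set C : ρ → Op (TorusSite d L) (n + 1) := fun _ => totalSpin n 2 with hC
  set Wt : ρ → Op (TorusSite d L) (n + 1) := fun j => (b j / mq j) • Γ' (W j) with hWt
  have hCH : ∀ j ∈ u, C j * H = H * C j := fun _ _ =>
    (commute_heisenbergHamiltonian_totalSpin n (torusGraph d L) J 2).symm.eq
  have hcharged : ∀ j ∈ u, Γ' (b j • W j) = C j * Wt j - Wt j * C j := by
    intro j hj
    rw [hC, hWt]
    simp only [Matrix.mul_smul, Matrix.smul_mul]
    rw [← smul_sub, hΓ', totalSpin_commutator_spinEmbed, hW j hj, map_smul, map_smul, smul_smul,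
      div_mul_cancel₀ _ (hmq j hj)]
  -- residual
  have hMt : ∀ k ∈ w, (Γ' (M k)).IsContraction := fun k hk => isContraction_spinEmbed _ (hM k hk)
  -- the identity on the torus
  have htorus : X - (c : ℂ) • (1 : Op (TorusSite d L) (n + 1)) =
      gramForm Λm (fun i => Γ' (O i)) +
        (∑ k ∈ s, (H * Γ' (spinEmbed (siteIncl hΛ) (B k)) - Γ' (spinEmbed (siteIncl hΛ) (B k)) * H) +
          ∑ l ∈ tt, (Us l * Yt l * (Us l)ᴴ - Yt l) +
          ∑ i ∈ (∅ : Finset (Fin 0)), ((0 : Op (TorusSite d L) (n + 1)) *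
              ((0 : Op (TorusSite d L) (n + 1)) - (((0 : ℝ) : ℝ) : ℂ) • 1) +
            ((0 : Op (TorusSite d L) (n + 1)) - (((0 : ℝ) : ℝ) : ℂ) • 1) * (0 : Op (TorusSite d L) (n + 1))) +
          ∑ j ∈ u, (C j * Wt j - Wt j * C j)) +
        (∑ m' ∈ ah, ((dc m' : ℝ) : ℂ) • ((Γ' (V m'))ᴴ - Γ' (V m')) + ∑ k ∈ w, a k • Γ' (M k)) := by
    have key := congrArg Γ' hcert
    rw [map_sub, map_smul Γ' ((c : ℝ) : ℂ) (1 : Op ↥Λ' (n + 1)), map_one] at key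
    have h1 : Γ' (∑ k ∈ s, (heisenbergHamiltonian n (windowGraph Λ') J * spinEmbed (siteIncl hΛ) (B k) -
        spinEmbed (siteIncl hΛ) (B k) * heisenbergHamiltonian n (windowGraph Λ') J)) =
        ∑ k ∈ s, (H * Γ' (spinEmbed (siteIncl hΛ) (B k)) - Γ' (spinEmbed (siteIncl hΛ) (B k)) * H) := by
      rw [map_sum]
      refine Finset.sum_congr rfl fun k _ => ?_
      rw [hH, hΓ', heisenbergTorus_commutator_spinEmbed n J hΛ hclosed hInj (B k)]
    have h2 : Γ' (∑ l ∈ tt, D l) = ∑ l ∈ tt, (Us l * Yt l * (Us l)ᴴ - Yt l) := by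
      rw [map_sum]
      refine Finset.sum_congr rfl fun l hl => ?_
      rw [hUs, hΓ']
      exact hD l hl
    have h3 : Γ' (∑ j ∈ u, b j • W j) = ∑ j ∈ u, (C j * Wt j - Wt j * C j) := by
      rw [map_sum]
      exact Finset.sum_congr rfl hcharged
    have h4 : Γ' (∑ m' ∈ ah, ((dc m' : ℝ) : ℂ) • ((V m')ᴴ - V m')) =
        ∑ m' ∈ ah, ((dc m' : ℝ) : ℂ) • ((Γ' (V m'))ᴴ - Γ' (V m')) := by
      rw [map_sum]
      refine Finset.sum_congr rfl fun m' _ => ?_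
      rw [map_smul, map_sub, hΓ', spinEmbed_conjTranspose]
    have h5 : Γ' (∑ k ∈ w, a k • M k) = ∑ k ∈ w, a k • Γ' (M k) := by
      rw [map_sum]
      exact Finset.sum_congr rfl fun k _ => by rw [map_smul]
    rw [hX, key, map_add, map_add, map_add, map_add, map_add, hΓ', spinEmbed_gramForm, ← hΓ', h1, h2, h3,
      h4, h5, Finset.sum_empty, add_zero]
  have hmain := Matrix.mul_card_le_minEnergyOn_of_local_certificate hHh ⊤ (fun _ _ => Submodule.mem_top) hK
    X T hTH (fun _ _ _ => Submodule.mem_top) (fun _ _ _ => Submodule.mem_top) hTT hsum hΛm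
    (fun i => Γ' (O i)) s (fun k => Γ' (spinEmbed (siteIncl hΛ) (B k))) tt Us Yt hU
    (fun _ _ _ _ => Submodule.mem_top) (fun _ _ _ _ => Submodule.mem_top) hUU
    (∅ : Finset (Fin 0)) (fun _ => 0) (fun _ => 0) (fun _ => 0) (fun _ => 0)
    (fun i hi => absurd hi (Finset.notMem_empty i)) (fun i hi => absurd hi (Finset.notMem_empty i))
    u C Wt hCH (fun _ _ _ _ => Submodule.mem_top) (fun _ _ _ _ => Submodule.mem_top)
    ah dc (fun m' => Γ' (V m')) w a (fun k => Γ' (M k)) hMt htorus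
  rw [card_torusSite (d := d) (L := L), Nat.cast_pow, Matrix.minEnergyOn_top_holds hHh] at hmain
  exact hmain

end Workhorse

/-! ### Every `d`: symmetry reductions along the affine maps `x ↦ εx + v` -/

section Affine

variable {d L : ℕ} [NeZero L]

/-- **Window certificate with affine reductions ⇒ ground-state energy of every large Heisenberg
torus `(ℤ/Lℤ)^d`.** As `heisenbergChain_groundEnergy_ge_of_window_certificate`
(HeisenbergWindowCertificate) in every dimension `d`: the objective is the energy density
`J Σᵢ 𝐒_0 · 𝐒_{eᵢ}`, the symmetry differences are
`Γ(incl)(Γ(affEmb εₗ vₗ) Yₗ) − Γ(incl) Yₗ` along `x ↦ εₗx + vₗ` (`εₗ = ±1`: translations and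
inversions; `εₗΛ + vₗ ⊆ Λ'`), and the conclusion is
`(c − Σₖ ‖aₖ‖) · L^d ≤ groundEnergy (heisenbergHamiltonian n (torusGraph d L) J)` for every `L ≥ 3`
with `x ↦ x mod L` injective on `Λ'`. Han 2020 §2. [cite: Han2020Bootstrap, §2] -/
theorem heisenbergLattice_groundEnergy_ge_of_window_certificate (n : ℕ) (J : ℝ) (hL : 3 ≤ L)
    {Λ Λ' : Finset (Site d)} (hΛ : Λ ⊆ Λ')
    (hclosed : ∀ x ∈ Λ, ∀ i : Fin d, x + unitVec i ∈ Λ' ∧ x - unitVec i ∈ Λ')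
    (hz : (0 : Site d) ∈ Λ') (he : ∀ i : Fin d, (unitVec i : Site d) ∈ Λ')
    (hInj : Set.InjOn (Torus.proj (d := d) L) ↑Λ')
    {m : Type*} [Fintype m] [DecidableEq m] {Λm : Matrix m m ℂ} (hΛm : Λm.PosSemidef)
    (O : m → Op ↥Λ' (n + 1))
    {κ : Type*} (s : Finset κ) (B : κ → Op ↥Λ (n + 1))
    {ι : Type*} (tt : Finset ι) (ε : ι → ℤˣ) (v : ι → Site d)
    (hsh : ∀ l, affShiftSet (ε l) (v l) Λ ⊆ Λ') (Y : ι → Op ↥Λ (n + 1))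
    {ρ : Type*} (u : Finset ρ) (b : ρ → ℂ) (W : ρ → Op ↥Λ' (n + 1)) (mq : ρ → ℂ)
    (hmq : ∀ j ∈ u, mq j ≠ 0)
    (hW : ∀ j ∈ u, totalSpin n 2 * W j - W j * totalSpin n 2 = mq j • W j)
    {δ : Type*} (ah : Finset δ) (dc : δ → ℝ) (V : δ → Op ↥Λ' (n + 1))
    {κ'' : Type*} (w : Finset κ'') (a : κ'' → ℂ) (M : κ'' → Op ↥Λ' (n + 1))
    (hM : ∀ k ∈ w, (M k).IsContraction) {c : ℝ}
    (hcert : (J : ℂ) • (∑ i : Fin d, spinDot n (⟨0, hz⟩ : ↥Λ') ⟨unitVec i, he i⟩) -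
        (c : ℂ) • (1 : Op ↥Λ' (n + 1)) =
      gramForm Λm O +
        (∑ k ∈ s, (heisenbergHamiltonian n (windowGraph Λ') J * spinEmbed (siteIncl hΛ) (B k) -
            spinEmbed (siteIncl hΛ) (B k) * heisenbergHamiltonian n (windowGraph Λ') J) +
          ∑ l ∈ tt, (spinEmbed (siteIncl (hsh l)) (spinEmbed (siteAffEmb (ε l) (v l) Λ) (Y l)) -
            spinEmbed (siteIncl hΛ) (Y l)) +
          ∑ j ∈ u, b j • W j) +
        (∑ m' ∈ ah, ((dc m' : ℝ) : ℂ) • ((V m')ᴴ - V m') + ∑ k ∈ w, a k • M k)) :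
    (c - ∑ k ∈ w, ‖a k‖) * (L : ℝ) ^ d ≤ (heisenbergHamiltonian n (torusGraph d L) J).groundEnergy := by
  have hInjΛ : Set.InjOn (Torus.proj (d := d) L) ↑Λ := hInj.mono (by exact_mod_cast hΛ)
  exact heisenbergTorus_groundEnergy_ge_of_window_certificate_perm n J hL hΛ hclosed hz he hInj hΛm O s B
    tt (fun l => torusAff (ε l) (Torus.proj L (v l))) (fun l _ x y => torusGraph_adj_torusAff _ _ x y)
    (fun l => spinEmbed (siteIncl (hsh l)) (spinEmbed (siteAffEmb (ε l) (v l) Λ) (Y l)) -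
      spinEmbed (siteIncl hΛ) (Y l))
    (fun l => spinEmbed (spinToTorusEmb L hInjΛ) (Y l))
    (fun l _ => spinEmbed_toTorus_aff_sub hΛ (ε l) (v l) (hsh l) hInj (Y l))
    u b W mq hmq hW ah dc V w a M hM hcert

/-- **Per-site form**: with the data of `heisenbergLattice_groundEnergy_ge_of_window_certificate`,
`c − Σₖ ‖aₖ‖ ≤ groundEnergy (heisenbergHamiltonian n (torusGraph d L) J) / L^d` for every `L ≥ 3`
with `x ↦ x mod L` injective on `Λ'`. [cite: Han2020Bootstrap, §2] -/
theorem heisenbergLattice_groundEnergy_div_ge_of_window_certificate (n : ℕ) (J : ℝ) (hL : 3 ≤ L)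
    {Λ Λ' : Finset (Site d)} (hΛ : Λ ⊆ Λ')
    (hclosed : ∀ x ∈ Λ, ∀ i : Fin d, x + unitVec i ∈ Λ' ∧ x - unitVec i ∈ Λ')
    (hz : (0 : Site d) ∈ Λ') (he : ∀ i : Fin d, (unitVec i : Site d) ∈ Λ')
    (hInj : Set.InjOn (Torus.proj (d := d) L) ↑Λ')
    {m : Type*} [Fintype m] [DecidableEq m] {Λm : Matrix m m ℂ} (hΛm : Λm.PosSemidef)
    (O : m → Op ↥Λ' (n + 1))
    {κ : Type*} (s : Finset κ) (B : κ → Op ↥Λ (n + 1))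
    {ι : Type*} (tt : Finset ι) (ε : ι → ℤˣ) (v : ι → Site d)
    (hsh : ∀ l, affShiftSet (ε l) (v l) Λ ⊆ Λ') (Y : ι → Op ↥Λ (n + 1))
    {ρ : Type*} (u : Finset ρ) (b : ρ → ℂ) (W : ρ → Op ↥Λ' (n + 1)) (mq : ρ → ℂ)
    (hmq : ∀ j ∈ u, mq j ≠ 0)
    (hW : ∀ j ∈ u, totalSpin n 2 * W j - W j * totalSpin n 2 = mq j • W j)
    {δ : Type*} (ah : Finset δ) (dc : δ → ℝ) (V : δ → Op ↥Λ' (n + 1))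
    {κ'' : Type*} (w : Finset κ'') (a : κ'' → ℂ) (M : κ'' → Op ↥Λ' (n + 1))
    (hM : ∀ k ∈ w, (M k).IsContraction) {c : ℝ}
    (hcert : (J : ℂ) • (∑ i : Fin d, spinDot n (⟨0, hz⟩ : ↥Λ') ⟨unitVec i, he i⟩) -
        (c : ℂ) • (1 : Op ↥Λ' (n + 1)) =
      gramForm Λm O +
        (∑ k ∈ s, (heisenbergHamiltonian n (windowGraph Λ') J * spinEmbed (siteIncl hΛ) (B k) -
            spinEmbed (siteIncl hΛ) (B k) * heisenbergHamiltonian n (windowGraph Λ') J) +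
          ∑ l ∈ tt, (spinEmbed (siteIncl (hsh l)) (spinEmbed (siteAffEmb (ε l) (v l) Λ) (Y l)) -
            spinEmbed (siteIncl hΛ) (Y l)) +
          ∑ j ∈ u, b j • W j) +
        (∑ m' ∈ ah, ((dc m' : ℝ) : ℂ) • ((V m')ᴴ - V m') + ∑ k ∈ w, a k • M k)) :
    c - ∑ k ∈ w, ‖a k‖ ≤
      (heisenbergHamiltonian n (torusGraph d L) J).groundEnergy / ((L : ℝ) ^ d) := by
  have hL0 : (0 : ℝ) < (L : ℝ) ^ d := pow_pos (by exact_mod_cast (show 0 < L by omega)) d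
  rw [le_div_iff₀ hL0]
  exact heisenbergLattice_groundEnergy_ge_of_window_certificate n J hL hΛ hclosed hz he hInj hΛm O s B tt
    ε v hsh Y u b W mq hmq hW ah dc V w a M hM hcert

end Affine

/-! ### `d = 2`: symmetry reductions along the affine `D₄` maps `x ↦ γ·x + w` -/

section D4Maps

variable {L : ℕ}

/-- **The affine `D₄` map of a region as an injection of sites**, `x ↦ γ·x + w` from the sites of
`Λ ⊆ ℤ²` to those of `γΛ + w` (`d4ShiftSet`; spin-system form of `PolySite.d4Emb`).
[cite: Scalapino1995, §2] -/
def siteD4Emb (γ : DihedralGroup 4) (w : Site 2) (Λ : Finset (Site 2)) : ↥Λ ↪ ↥(d4ShiftSet γ w Λ) :=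
  ⟨fun x => ⟨d4Vec γ x.1 + w, d4Vec_add_mem_d4ShiftSet γ w x.2⟩,
    fun _ _ hxy => Subtype.ext (d4Vec_injective γ (add_right_cancel (congrArg Subtype.val hxy)))⟩

/-- `siteD4Emb` on underlying sites. [folklore] -/
@[simp] theorem coe_siteD4Emb (γ : DihedralGroup 4) (w : Site 2) (Λ : Finset (Site 2)) (x : ↥Λ) :
    ((siteD4Emb γ w Λ x : ↥(d4ShiftSet γ w Λ)) : Site 2) = d4Vec γ x + w := rfl

/-- **The affine `D₄` map `y ↦ γ·y + w` of the discrete torus `(ℤ/Lℤ)²`**, a permutation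
(`d4SitePerm γ` followed by the translation by `w`). [cite: Scalapino1995, §2] -/
def torusD4Aff (γ : DihedralGroup 4) (w : TorusSite 2 L) : Equiv.Perm (TorusSite 2 L) :=
  (d4SitePerm (L := L) γ).trans (Equiv.addRight w)

/-- `torusD4Aff γ w y = γ·y + w`. [folklore] -/
@[simp] theorem torusD4Aff_apply (γ : DihedralGroup 4) (w y : TorusSite 2 L) :
    torusD4Aff γ w y = d4Site γ y + w := rfl

/-- `(γ·x + w) mod L = γ·(x mod L) + (w mod L)`. [folklore] -/
theorem Torus.proj_d4Vec_add (L : ℕ) (γ : DihedralGroup 4) (w x : Site 2) :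
    Torus.proj L (d4Vec γ x + w) = torusD4Aff γ (Torus.proj L w) (Torus.proj L x) := by
  have hadd : Torus.proj L (d4Vec γ x + w) = Torus.proj L (d4Vec γ x) + Torus.proj L w := by
    funext i; simp [Torus.proj]
  rw [hadd, Torus.proj_d4Vec, torusD4Aff_apply]

/-- Pulling back the `D₄`-image is the torus `D₄` map of the pull-back:
`ι_{γΛ+w,L} ∘ d4Emb = (y ↦ γ·y + (w mod L)) ∘ ι_{Λ,L}`. [folklore] -/
theorem siteD4Emb_trans_spinToTorusEmb (L : ℕ) (γ : DihedralGroup 4) (w : Site 2) {Λ : Finset (Site 2)}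
    (h : Set.InjOn (Torus.proj (d := 2) L) ↑Λ)
    (h' : Set.InjOn (Torus.proj (d := 2) L) ↑(d4ShiftSet γ w Λ)) :
    (siteD4Emb γ w Λ).trans (spinToTorusEmb L h') =
      (spinToTorusEmb L h).trans (torusD4Aff γ (Torus.proj L w)).toEmbedding :=
  DFunLike.ext _ _ fun x => by
    rw [Function.Embedding.trans_apply, Function.Embedding.trans_apply, spinToTorusEmb_apply,
      spinToTorusEmb_apply, Equiv.coe_toEmbedding, coe_siteD4Emb, Torus.proj_d4Vec_add]

end D4Maps

section D4

variable {L : ℕ} [NeZero L]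

/-- `y ↦ γ·y + w` is an automorphism of the nearest-neighbour graph of the square torus
(`torusGraph_adj_d4Site_iff` and translation invariance). [cite: Scalapino1995, §2] -/
theorem torusGraph_adj_torusD4Aff (γ : DihedralGroup 4) (w x y : TorusSite 2 L) :
    (torusGraph 2 L).Adj (torusD4Aff γ w x) (torusD4Aff γ w y) ↔ (torusGraph 2 L).Adj x y := by
  have h := torusGraph_adj_torusAff (1 : ℤˣ) w (d4Site γ x) (d4Site γ y)
  rw [torusAff_one] at h
  rw [torusD4Aff_apply, torusD4Aff_apply, ← torusGraph_adj_d4Site_iff γ x y, ← h]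
  rfl

/-- The permutation unitary of `y ↦ γ·y + w` commutes with the Heisenberg Hamiltonian of the
square torus. [cite: Tasaki2020, §2.4] -/
theorem permOp_torusD4Aff_mul_heisenbergHamiltonian (n : ℕ) (γ : DihedralGroup 4) (w : TorusSite 2 L)
    (J : ℝ) :
    permOp (torusD4Aff γ w) * heisenbergHamiltonian n (torusGraph 2 L) J =
      heisenbergHamiltonian n (torusGraph 2 L) J * permOp (torusD4Aff γ w) :=
  (permOp_mul_eq_mul_permOp_iff _ _).2
    (reindexOp_heisenbergHamiltonian n _ _ (torusD4Aff γ w) (torusGraph_adj_torusD4Aff γ w) J)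

/-- **Affine `D₄` differences in the window become symmetry defects on the torus**:
`Γ(ι_{Λ'})(Γ(incl)(Γ(d4Emb γ w) Y) − Γ(incl) Y) = P (Γ(ι_Λ) Y) Pᴴ − Γ(ι_Λ) Y` with `P` the
permutation unitary of `y ↦ γ·y + (w mod L)`. Han 2020 §3 (`F[U⁻¹OU] = F[O]`, `U ∈ {T, Π, R}`).
[cite: Han2020Bootstrap, §3] -/
theorem spinEmbed_toTorus_d4_sub {q : ℕ} {Λ Λ' : Finset (Site 2)} (hΛ : Λ ⊆ Λ') (γ : DihedralGroup 4)
    (w : Site 2) (hsh : d4ShiftSet γ w Λ ⊆ Λ') (h' : Set.InjOn (Torus.proj (d := 2) L) ↑Λ')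
    (Y : Op ↥Λ q) :
    spinEmbed (spinToTorusEmb L h')
        (spinEmbed (siteIncl hsh) (spinEmbed (siteD4Emb γ w Λ) Y) - spinEmbed (siteIncl hΛ) Y) =
      permOp (torusD4Aff γ (Torus.proj L w)) *
          spinEmbed (spinToTorusEmb L (h'.mono (by exact_mod_cast hΛ))) Y *
          (permOp (torusD4Aff γ (Torus.proj L w)))ᴴ -
        spinEmbed (spinToTorusEmb L (h'.mono (by exact_mod_cast hΛ))) Y := by
  rw [map_sub, spinEmbed_toTorus_incl hΛ h', spinEmbed_toTorus_incl hsh h', spinEmbed_spinEmbed,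
    siteD4Emb_trans_spinToTorusEmb L γ w (h'.mono (by exact_mod_cast hΛ)) (h'.mono (by exact_mod_cast hsh)),
    permOp_conj_spinEmbed]

/-- **Window certificate with affine `D₄` reductions ⇒ ground-state energy of every large square
Heisenberg torus.** As `heisenbergLattice_groundEnergy_ge_of_window_certificate` in `d = 2`, with
the symmetry family of AFFINE `D₄` maps `x ↦ γₗ·x + wₗ` of `ℤ²` (`γₗ ∈ D₄` acting by `d4Vec`;
translations are `γₗ = 1`; `γₗΛ + wₗ ⊆ Λ'`) — the full set of square-lattice constraints
`T_(1,0), T_(0,1), Π, R` of Han's bootstrap and the `point_group` reductions of the bundle's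
two-dimensional reduce-mode certificates: the window identity
`J (𝐒_0·𝐒_{e₀} + 𝐒_0·𝐒_{e₁}) − c·1 = Σ Λₐᵦ Oₐᴴ O_b + (Σₖ [H_{Λ'}, Γ(incl) Bₖ]
   + Σₗ (Γ(incl)(Γ(d4Emb γₗ wₗ) Yₗ) − Γ(incl) Yₗ) + Σⱼ bⱼ • Wⱼ) + (Σₘ dₘ • (Vₘᴴ − Vₘ) + Σₖ aₖ • Mₖ)`
gives `(c − Σₖ ‖aₖ‖) · L² ≤ groundEnergy (heisenbergHamiltonian n (torusGraph 2 L) J)` for every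
`L ≥ 3` with `x ↦ x mod L` injective on `Λ'`. Han 2020 §3. [cite: Han2020Bootstrap, §3] -/
theorem heisenbergSquare_groundEnergy_ge_of_window_certificate_d4 (n : ℕ) (J : ℝ) (hL : 3 ≤ L)
    {Λ Λ' : Finset (Site 2)} (hΛ : Λ ⊆ Λ')
    (hclosed : ∀ x ∈ Λ, ∀ i : Fin 2, x + unitVec i ∈ Λ' ∧ x - unitVec i ∈ Λ')
    (hz : (0 : Site 2) ∈ Λ') (he : ∀ i : Fin 2, (unitVec i : Site 2) ∈ Λ')
    (hInj : Set.InjOn (Torus.proj (d := 2) L) ↑Λ')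
    {m : Type*} [Fintype m] [DecidableEq m] {Λm : Matrix m m ℂ} (hΛm : Λm.PosSemidef)
    (O : m → Op ↥Λ' (n + 1))
    {κ : Type*} (s : Finset κ) (B : κ → Op ↥Λ (n + 1))
    {ι : Type*} (tt : Finset ι) (γ : ι → DihedralGroup 4) (wv : ι → Site 2)
    (hsh : ∀ l, d4ShiftSet (γ l) (wv l) Λ ⊆ Λ') (Y : ι → Op ↥Λ (n + 1))
    {ρ : Type*} (u : Finset ρ) (b : ρ → ℂ) (W : ρ → Op ↥Λ' (n + 1)) (mq : ρ → ℂ)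
    (hmq : ∀ j ∈ u, mq j ≠ 0)
    (hW : ∀ j ∈ u, totalSpin n 2 * W j - W j * totalSpin n 2 = mq j • W j)
    {δ : Type*} (ah : Finset δ) (dc : δ → ℝ) (V : δ → Op ↥Λ' (n + 1))
    {κ'' : Type*} (w : Finset κ'') (a : κ'' → ℂ) (M : κ'' → Op ↥Λ' (n + 1))
    (hM : ∀ k ∈ w, (M k).IsContraction) {c : ℝ}
    (hcert : (J : ℂ) • (∑ i : Fin 2, spinDot n (⟨0, hz⟩ : ↥Λ') ⟨unitVec i, he i⟩) -
        (c : ℂ) • (1 : Op ↥Λ' (n + 1)) =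
      gramForm Λm O +
        (∑ k ∈ s, (heisenbergHamiltonian n (windowGraph Λ') J * spinEmbed (siteIncl hΛ) (B k) -
            spinEmbed (siteIncl hΛ) (B k) * heisenbergHamiltonian n (windowGraph Λ') J) +
          ∑ l ∈ tt, (spinEmbed (siteIncl (hsh l)) (spinEmbed (siteD4Emb (γ l) (wv l) Λ) (Y l)) -
            spinEmbed (siteIncl hΛ) (Y l)) +
          ∑ j ∈ u, b j • W j) +
        (∑ m' ∈ ah, ((dc m' : ℝ) : ℂ) • ((V m')ᴴ - V m') + ∑ k ∈ w, a k • M k)) :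
    (c - ∑ k ∈ w, ‖a k‖) * (L : ℝ) ^ 2 ≤ (heisenbergHamiltonian n (torusGraph 2 L) J).groundEnergy := by
  have hInjΛ : Set.InjOn (Torus.proj (d := 2) L) ↑Λ := hInj.mono (by exact_mod_cast hΛ)
  exact heisenbergTorus_groundEnergy_ge_of_window_certificate_perm n J hL hΛ hclosed hz he hInj hΛm O s B
    tt (fun l => torusD4Aff (γ l) (Torus.proj L (wv l))) (fun l _ x y => torusGraph_adj_torusD4Aff _ _ x y)
    (fun l => spinEmbed (siteIncl (hsh l)) (spinEmbed (siteD4Emb (γ l) (wv l) Λ) (Y l)) -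
      spinEmbed (siteIncl hΛ) (Y l))
    (fun l => spinEmbed (spinToTorusEmb L hInjΛ) (Y l))
    (fun l _ => spinEmbed_toTorus_d4_sub hΛ (γ l) (wv l) (hsh l) hInj (Y l))
    u b W mq hmq hW ah dc V w a M hM hcert

/-- **Per-site form, in the shape of the bundle's square-torus-wise thermodynamic-limit rows**
(`HubbardCertifiedBounds.sdp_lower_TL_heisSQ_…`: `∀ L ≥ L₀, q ≤ E₀(H_{L×L})/L²`): with the data of
`heisenbergSquare_groundEnergy_ge_of_window_certificate_d4`,
`c − Σₖ ‖aₖ‖ ≤ groundEnergy (heisenbergHamiltonian n (torusGraph 2 L) J) / L²` for every `L ≥ 3`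
with `x ↦ x mod L` injective on `Λ'` (for all `L ≥ spread(Λ') + 1`). [cite: Han2020Bootstrap, §3] -/
theorem heisenbergSquare_groundEnergy_div_ge_of_window_certificate_d4 (n : ℕ) (J : ℝ) (hL : 3 ≤ L)
    {Λ Λ' : Finset (Site 2)} (hΛ : Λ ⊆ Λ')
    (hclosed : ∀ x ∈ Λ, ∀ i : Fin 2, x + unitVec i ∈ Λ' ∧ x - unitVec i ∈ Λ')
    (hz : (0 : Site 2) ∈ Λ') (he : ∀ i : Fin 2, (unitVec i : Site 2) ∈ Λ')
    (hInj : Set.InjOn (Torus.proj (d := 2) L) ↑Λ')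
    {m : Type*} [Fintype m] [DecidableEq m] {Λm : Matrix m m ℂ} (hΛm : Λm.PosSemidef)
    (O : m → Op ↥Λ' (n + 1))
    {κ : Type*} (s : Finset κ) (B : κ → Op ↥Λ (n + 1))
    {ι : Type*} (tt : Finset ι) (γ : ι → DihedralGroup 4) (wv : ι → Site 2)
    (hsh : ∀ l, d4ShiftSet (γ l) (wv l) Λ ⊆ Λ') (Y : ι → Op ↥Λ (n + 1))
    {ρ : Type*} (u : Finset ρ) (b : ρ → ℂ) (W : ρ → Op ↥Λ' (n + 1)) (mq : ρ → ℂ)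
    (hmq : ∀ j ∈ u, mq j ≠ 0)
    (hW : ∀ j ∈ u, totalSpin n 2 * W j - W j * totalSpin n 2 = mq j • W j)
    {δ : Type*} (ah : Finset δ) (dc : δ → ℝ) (V : δ → Op ↥Λ' (n + 1))
    {κ'' : Type*} (w : Finset κ'') (a : κ'' → ℂ) (M : κ'' → Op ↥Λ' (n + 1))
    (hM : ∀ k ∈ w, (M k).IsContraction) {c : ℝ}
    (hcert : (J : ℂ) • (∑ i : Fin 2, spinDot n (⟨0, hz⟩ : ↥Λ') ⟨unitVec i, he i⟩) -
        (c : ℂ) • (1 : Op ↥Λ' (n + 1)) =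
      gramForm Λm O +
        (∑ k ∈ s, (heisenbergHamiltonian n (windowGraph Λ') J * spinEmbed (siteIncl hΛ) (B k) -
            spinEmbed (siteIncl hΛ) (B k) * heisenbergHamiltonian n (windowGraph Λ') J) +
          ∑ l ∈ tt, (spinEmbed (siteIncl (hsh l)) (spinEmbed (siteD4Emb (γ l) (wv l) Λ) (Y l)) -
            spinEmbed (siteIncl hΛ) (Y l)) +
          ∑ j ∈ u, b j • W j) +
        (∑ m' ∈ ah, ((dc m' : ℝ) : ℂ) • ((V m')ᴴ - V m') + ∑ k ∈ w, a k • M k)) :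
    c - ∑ k ∈ w, ‖a k‖ ≤
      (heisenbergHamiltonian n (torusGraph 2 L) J).groundEnergy / ((L : ℝ) ^ 2) := by
  have hL0 : (0 : ℝ) < (L : ℝ) ^ 2 := pow_pos (by exact_mod_cast (show 0 < L by omega)) 2
  rw [le_div_iff₀ hL0]
  exact heisenbergSquare_groundEnergy_ge_of_window_certificate_d4 n J hL hΛ hclosed hz he hInj hΛm O s B
    tt γ wv hsh Y u b W mq hmq hW ah dc V w a M hM hcert

end D4

end Literature.MathematicalPhysics.QuantumLattice
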